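/-
Copyright: statement-level skeleton of a published paper (lit-balaban cell, Phase-2 proof seat p39 gen 18). No proof claims
beyond what the kernel checks below.
-/
import Literature.MathematicalPhysics.QuantumFieldTheory.Balaban1983to89.B3Eq334ZeroLattice
import Literature.MathematicalPhysics.QuantumFieldTheory.Balaban1983to89.B3Eq337ZeroLattice
import Literature.MathematicalPhysics.QuantumFieldTheory.Balaban1983to89.B3Eq338ZeroLattice
import Literature.MathematicalPhysics.QuantumFieldTheory.Balaban1983to89.B3GscaleLatRescaling

/-!
# Bałaban, *(Higgs)₂,₃ quantum fields in a finite volume. III*, CMP 88 (1983), p. 444: the factor `Σ_{x,x″}η^{2d}Γ′_μ(x,x′,x″)` of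
# (3.36) for the graphs (2.19) and (2.20) ON THE PRINT'S CARRIER `ηℤ³` — *"is of degree 0, so it is equal to the same expression but
# on the scale ξ instead of η, ξ = L^{−j₀}"* STAND-ALONE, its `Λ, Λ″ ↑ ℤ³` limits, and the closing of the chain (3.33) → (3.36) →
# (3.37)/(3.38): the (3.36) vertex coefficient is bounded uniformly

[cite: Balaban1983Higgs3, (3.36)–(3.38) p.444 (PDF 34)].  Unit `lit-balaban-p39-g18` (Phase-2 proof seat p39, gen 18), FILE 3 of the
(3.33)–(3.36) lattice chain = the fold owner's residual **(d)** of row `B3.Eq3.33-3.38` (r15 g14, 2026-08-23T03:17:28Z).  statement-level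
skeleton of published theorems with citation tags; proofs where landed; nothing here is a claim about the Yang–Mills mass gap.
v1.1 (p39 gen 22, 2026-08-23; DOC-ONLY, declarations byte-identical to v1.0 p351661; referee ref-1 g79 record-only note):
the p. 444 quotes restore the printed η superscripts — «Now we replace the propagators G^η_{j₀}(0), G^η_{j₀} by C^ξ» and «the
expressions of the same type but with propagators G^η_{j₀}(0), G^η_{j₀}» (render p034 read).  Nothing else changed.

PDF held: `paper:balaban1983-higgs-2-3-quantum-fields-finite-volume` (journal page = PDF page + 410); p. 444 read in the OCR text (`p0034.txt`
of `lit read`) and on the ×2 render `run/shared/lean/pub/pub-balaban/b2b-balaban-ref1/pages/1983-cmp88-higgs23-III/1983-cmp88-higgs23-III-p034-x2.png`.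

THE PRINTED TEXT (verbatim, p. 444): *"Now we can analyze the factor Σ_{x,x″}η^{2d}Γ′_μ(x,x′,x″) for all the renormalized classes. … To
analyze the remaining graphs we have to transform it further. The expression Σ_{x,x″}η^{2d}Γ′_μ(x,x′,x″) is of degree 0, so it is equal
to the same expression but on the scale ξ instead of η, ξ = L^{−j₀}. Now we replace the propagators G^η_{j₀}(0), G^η_{j₀} by C^ξ in the way
described several times. We get a convergent expression plus Σ_{y,y″}ξ^{2d}Γ″_μ(y,y′,y″) defined with the help of the propagator C^ξ.
This expression for the graphs (2.19) equals [(3.37)] = 0. … Finally for the graphs (2.20) it equals [(3.38)] = 0"*.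

CITATION HEADER (lean-in-tree rule).  FILE 1 = `B3Eq334ZeroLattice` ((3.33)/(3.34)/(3.36) on `ηℤ^{d+1}`: `Kernel3Z`, `local336Z`,
`local336Z_resum`); the ξ-lattice files of record for the sentences AFTER the rescaling are p39 g10's `B3Eq337ZeroLattice` (`tri19` = the
factor for the graphs (2.19) with kernel slots, `exists_tri19_bound`) and `B3Eq338KernelForm`/`B3Eq338ZeroLattice` (`tri20` = the factor
for the graphs (2.20), `exists_tri20_bound`), on gen 9's infinite-lattice kernels (`B3Eq316ResolventZeroLattice.GxiL ℓ j a m² = G^ξ_j(0)`,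
`xiOf ℓ j = L^{−j}`, `B3Eq316DifferenceKernelBounds.dK1/dK2/d2K` = `∂^ξK`, `K∂^{ξ*}`, `∂^ξK∂^{ξ*}`, `prof`, `exists_bounds`); the `η`-lattice
reading of the `j₀`-th-step propagator is gen 11's `B3Eq330EtaZeroLattice.GetaL ℓ j₀ k = (L^{j₀}η)^{−1}·G^ξ_{j₀}(0)` (`scale330`,
`xiOf_eq_scale_mul`, `dK2_rescale`, `d2K_rescale`) and p26's resummed `GresumZ` is identified with it by p39 g17's
`B3GscaleLatRescaling.GresumZ_eq_GetaL`.  All consumed BY NAME; nothing of another seat is modified.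

WHAT IS PROVED (`d = 3`, zero field; kind «displays with bodies + model-free identities + model instance»).
* §1 THE (3.36) FACTOR for the graphs (2.19) and (2.20) on the `η`-lattice with FINITE windows: integrands `gam19`, `gam20` (the
  bracket of (3.37) resp. the `Σ_ν[…]` of (3.38) with arbitrary two-variable kernels in the line slots), finite-window factors `inner19Z`
  (`Σ_{x∈Λ}η³γ¹⁹`), `inner20Z` (`Σ_{x∈Λ,x″∈Λ″}η⁶γ²⁰`); dictionary to the ξ-lattice objects: `tri19_eq` (`tri19 = −q³·Σ'η³γ¹⁹`), `tri20_eq`;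
  and to FILE 1: the three-point kernel `Gamma20Z η T K₁ K₂ K₃` of (2.20) in `Kernel3Z 2 W` shape (`γ²⁰·T_μ`, `T` the charge map) with
  **`local336Z_Gamma20Z`**: (3.36) with this kernel IS the local vertex `Σ_{x′}η³Σ_μ locs A_μ φ′·(inner20Z(x′))·T_μφ″(x′)`, its
  trilinearity `Gamma20Z_sum` and the resummation **`local336Z_Gamma20Z_resum`** / **`local336Z_Gamma20Z_resum_zeroLattice`**
  (`Σ_{j₁,j₂,j₃<n}` over the pieces `gpieceZ` = the kernel at `GresumZ n`, `1 ≤ n ≤ k`).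
* §2 **THE RESCALING SENTENCE STAND-ALONE, model-free**: for every `r ≠ 0` and all kernels, `η³γ¹⁹_η[r⁻¹K₁,r⁻¹K₂] = ξ³γ¹⁹_ξ[K₁,K₂]` and
  `η⁶γ²⁰_η[r⁻¹K₁,r⁻¹K₂,r⁻¹K₃] = ξ⁶γ²⁰_ξ[K₁,K₂,K₃]` pointwise when `η = rξ` (`gam19_rescale`, `gam20_rescale` — degree `0`: the powers of `r`
  from the three (two) propagators, the three (one) lattice derivatives and the volume elements cancel exactly), hence
  **`inner19Z_rescale`**, **`inner20Z_rescale`** (finite windows) and **`tri19_rescale`**, **`tri20_rescale`** (whole lattice).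
* §3 AT THE PRINT'S PROPAGATOR: with `η = L^{−k}`, `ξ = L^{−j₀}`, `G^η_{j₀}(0) = GetaL ℓ j₀ k` in every slot, **`inner20Z_GetaL_eq`** /
  **`inner19Z_GetaL_eq`**: the `η`-lattice factor EQUALS the `ξ`-lattice factor of `G^ξ_{j₀}(0) = GxiL ℓ j₀` window by window
  (*"equal to the same expression but on the scale ξ"*), and `GresumZ_inner20Z_eq` hooks p26's resummed pieces (`m² ↦ m²/s²`).
* §4 THE `Λ″ ↑ ℤ³`, `Λ ↑ ℤ³` LIMITS at `G^ξ_{j₀}(0)` (summability from gen 9's laws: `summable_gam20_inner`, `summable_gam20_outer`):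
  `tendsto_inner20Z_inner`, `tendsto_inner20Z_outer`, `tendsto_inner19Z`, identifying the whole-lattice factor with `tri20`/`tri19`.
* §5 ASSEMBLY **`eq336_factor20_zeroLattice`** / **`eq336_factor19_zeroLattice`**: for `1 ≤ j₀ ≤ k` and every window point the (3.36)
  factor of the graphs (2.20) (resp. (2.19)) built from `G^η_{j₀}(0)` on `ηℤ³` equals its `ξ`-scale version, converges as the windows
  exhaust the lattice, and the limit times `−q³` is `tri20` (resp. `tri19`) at `G^ξ_{j₀}(0)`, which gen 10 bounds by `Cst·|q³|` UNIFORMLY in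
  `j₀`, the window and the position — the chain (3.33) → (3.34) → (3.36) → (3.37)/(3.38) closed on the print's carrier.

HONEST SCOPE / DECLARED DIVERGENCES (F7).  (i) `d = 3` only (degree `0` of the factor is the `d = 3` count; p. 441 *"We consider the case
d = 3"*); zero field; all line slots = the zero-field scalar propagator `G_{j₀}(0)` (the vector line `G_{j₀}` at `A = 0` has the same kernel
shape — the convention of gen 10's files; independent window points per slot are allowed where it costs nothing).  (ii) For the graphs
(2.19) the factor is typed at the COEFFICIENT level only (`inner19Z` ↔ `tri19`; its two lines join the same pair of vertices, so the
three-point shape of (3.33) degenerates) — the graph-level dictionary is given for (2.20), the print's own example (3.35).  (iii) The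
`Λ, Λ″` limits are taken iteratively (`Λ″` first at fixed `Λ`, then `Λ`), which is what the nested lattice sums of `tri20` mean.  (iv) The
replacement by `C^ξ`, (3.37), (3.38) themselves are NOT re-proved (cited by name from gen 10 / r15).  (v) The pictures (3.35) and the classes
(2.18)/(2.21b,c,g) (residuals (b), (c) of the row) are not touched.  Definitions with bodies and theorems; no Literature fact minted, no
`sorry`; standard axioms.  Value = the p. 444 rescaling sentence and the (3.36) → (3.37)/(3.38) hook on the printed carrier, NOT summit
progress.  HOME `run/shared/lean/pub/lit-balaban/` (row B3.Eq3.33-3.38, FILED.md, STATUS.md), 2026-08-23.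
-/

open scoped BigOperators RealInnerProductSpace
open Finset Filter Topology

namespace Literature.MathematicalPhysics.QuantumFieldTheory.Balaban1983to89.B3Eq336ScaleZeroLattice

open B3Sect3VectorSelfEnergy (ZSite unitVec Cxi)
open B3Eq316ResolventZeroLattice (xiOf GxiL xiOf_pos xiOf_le_one)
open B3Eq316DifferenceKernelBounds (prof dK1 dK2 d2K prof_nonneg prof_sub_comm prof_succ_le exists_bounds)
open B3Pi2ZeroLattice (prof_le_inv summable_prof_col summable_abs_bdd_mul_prof)
open B3Eq337ZeroLattice (tri19 convK summable_prof_sub exists_tri19_bound)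
open B3Eq338KernelForm (tri20)
open B3Eq338ZeroLattice (exists_tri20_bound)
open B3Eq330EtaZeroLattice (scale330 GetaL scale330_pos xiOf_eq_scale_mul GetaL_eq)
open B3Ineq313Lattice (KernelZ)
open B3Ineq314ZeroLattice (etaZ gpieceZ GresumZ sum_gpieceZ_range)
open B4Thm110ZeroBox (sc)
open B3GscaleLatRescaling (GresumZ_eq_GetaL)
open B3Eq334ZeroLattice
open _root_.Filter

noncomputable section

/-! ## §1 The factor `Σ_{x,x″}η^{2d}Γ′_μ(x,x′,x″)` of (3.36) for the graphs (2.19) and (2.20), with finite windows -/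

section Factor

/-- The integrand of the (3.36) factor for the graphs **(2.19)** with its two line slots as two-variable kernels on the `η`-lattice:
`γ¹⁹_μ(x,x′) = [(K₁∂^{η*}_μ)(x,x′) − (∂^η_μK₁)(x,x′)]·K₂(x,x′)` (the bracket of (3.37) before the replacement by `C^ξ`; gen 10's `tri19` is
`−q³Σ'_x η³γ¹⁹_μ(x,x′)`, `tri19_eq`). [cite: Balaban1983Higgs3, (3.37) p.444] -/
def gam19 (η : ℝ) (μ : Fin 3) (K₁ K₂ : ZSite 3 → ZSite 3 → ℝ) (x x' : ZSite 3) : ℝ :=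
  (dK2 η μ K₁ x x' - dK1 η μ K₁ x x') * K₂ x x'

/-- The integrand of the (3.36) factor for the graphs **(2.20)** with its three line slots (`K₁` on the line `x′–x`, differentiated at
`x′`; `K₂` on `x–x″`; `K₃` on `x′–x″`): `γ²⁰_μ(x,x′,x″) = Σ_ν[(∂^η_νK₁)(x′,x)(∂^η_μK₂∂^{η*}_ν)(x,x″)K₃(x′,x″) − (∂^η_νK₁∂^{η*}_μ)(x′,x)(K₂∂^{η*}_ν)(x,x″)
K₃(x′,x″)]` (the bracket of the first member of (3.38) before the replacement by `C^ξ`; gen 10's `tri20` is `−q³Σ'_xΣ'_{x″}η⁶γ²⁰`, `tri20_eq`).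
[cite: Balaban1983Higgs3, (3.38) p.444] -/
def gam20 (η : ℝ) (μ : Fin 3) (K₁ K₂ K₃ : ZSite 3 → ZSite 3 → ℝ) (x x' x'' : ZSite 3) : ℝ :=
  ∑ ν : Fin 3, (dK1 η ν K₁ x' x * d2K η μ ν K₂ x x'' * K₃ x' x'' - d2K η ν μ K₁ x' x * dK2 η ν K₂ x x'' * K₃ x' x'')

/-- **The (3.36) factor for the graphs (2.19) on the `η`-lattice with a finite window** `Λ ∋ x`: `Σ_{x∈Λ} η³ γ¹⁹_μ(x,x′)`.
[cite: Balaban1983Higgs3, (3.36) p.444] -/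
def inner19Z (η : ℝ) (μ : Fin 3) (K₁ K₂ : ZSite 3 → ZSite 3 → ℝ) (x' : ZSite 3) (Λ : Finset (ZSite 3)) : ℝ :=
  ∑ x ∈ Λ, η ^ 3 * gam19 η μ K₁ K₂ x x'

/-- **The (3.36) factor `Σ_{x,x″}η^{2d}Γ′_μ(x,x′,x″)` for the graphs (2.20) on the `η`-lattice with finite windows** `Λ ∋ x`, `Λ″ ∋ x″`
(`d = 3`: `η^{2d} = η⁶`): `Σ_{x∈Λ,x″∈Λ″} η⁶ γ²⁰_μ(x,x′,x″)`. [cite: Balaban1983Higgs3, (3.36) p.444] -/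
def inner20Z (η : ℝ) (μ : Fin 3) (K₁ K₂ K₃ : ZSite 3 → ZSite 3 → ℝ) (x' : ZSite 3) (Λ Λ'' : Finset (ZSite 3)) : ℝ :=
  ∑ x ∈ Λ, ∑ x'' ∈ Λ'', η ^ 6 * gam20 η μ K₁ K₂ K₃ x x' x''

/-- dictionary: gen 10's (2.19) factor on the whole lattice is `−q³Σ'_x η³γ¹⁹_μ(x,x′)`. [cite: Balaban1983Higgs3, (3.37) p.444] -/
theorem tri19_eq (η q3 : ℝ) (μ : Fin 3) (K₁ K₂ : ZSite 3 → ZSite 3 → ℝ) (x' : ZSite 3) :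
    tri19 η q3 μ K₁ K₂ x' = -q3 * ∑' x : ZSite 3, η ^ 3 * gam19 η μ K₁ K₂ x x' := rfl

/-- dictionary: gen 10's (2.20) factor on the whole lattice is `−q³Σ'_xΣ'_{x″} η⁶γ²⁰_μ(x,x′,x″)`. [cite: Balaban1983Higgs3, (3.38) p.444] -/
theorem tri20_eq (η q3 : ℝ) (μ : Fin 3) (K₁ K₂ K₃ : ZSite 3 → ZSite 3 → ℝ) (x' : ZSite 3) :
    tri20 η q3 μ K₁ K₂ K₃ x' = -q3 * ∑' x : ZSite 3, ∑' x'' : ZSite 3, η ^ 6 * gam20 η μ K₁ K₂ K₃ x x' x'' := rfl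

variable {W : Type*} [NormedAddCommGroup W] [InnerProductSpace ℝ W]

/-- **The three-point kernel `Γ′_μ(x,x′,x″)` of (3.36) for the graphs (2.20)** in FILE 1's `Kernel3Z` shape (`d + 1 = 3`): the scalar
bracket `γ²⁰_μ(x,x′,x″)` of (3.38) times a fixed charge map `T` of the internal indices (print: `−q³`).
[cite: Balaban1983Higgs3, (3.36) p.444, (3.38) p.444] -/
def Gamma20Z (η : ℝ) (T : W →ₗ[ℝ] W) (K₁ K₂ K₃ : KernelZ 2) : Kernel3Z 2 W :=
  fun μ x x' x'' => gam20 η μ K₁ K₂ K₃ x x' x'' • T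

/-- **(3.36) for the graphs (2.20) IS the local vertex with the factor `Σ_{x,x″}η^{2d}Γ′_μ`**: with the kernel `Gamma20Z`, FILE 1's (3.36)
reads `Σ_{x′∈Λ′} η³ Σ_μ locs(x′)A_μ(x′)·[Σ_{x∈Λ,x″∈Λ″}η⁶γ²⁰_μ(x,x′,x″)]·⟪φ′(x′), Tφ″(x′)⟫` — the finite-window factor `inner20Z` is exactly
the coefficient the p. 444 paragraph analyses. [cite: Balaban1983Higgs3, (3.36) p.444] -/
theorem local336Z_Gamma20Z (η : ℝ) (T : W →ₗ[ℝ] W) (K₁ K₂ K₃ : KernelZ 2) (locs : (Fin (2 + 1) → ℤ) → ℝ)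
    (A : Fin (2 + 1) → (Fin (2 + 1) → ℤ) → ℝ) (φ' φ'' : (Fin (2 + 1) → ℤ) → W) (Λ Λ' Λ'' : Finset (Fin (2 + 1) → ℤ)) :
    local336Z η (Gamma20Z η T K₁ K₂ K₃) locs A φ' φ'' Λ Λ' Λ'' =
      ∑ x' ∈ Λ', η ^ (2 + 1) * ∑ μ : Fin (2 + 1),
        locs x' * A μ x' * (inner20Z η μ K₁ K₂ K₃ x' Λ Λ'' * ⟪φ' x', T (φ'' x')⟫) := by
  simp only [local336Z, local334Z, Gamma20Z, inner20Z, smul_smul, ← Finset.sum_smul, LinearMap.smul_apply, inner_smul_right]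

/-! ### trilinearity of `Γ′` for (2.20) and the resummation of (3.36) over the line indices -/

/-- kernel: `∂^ηK` of a finite sum of kernels. [cite: Balaban1983Higgs3, (3.36) p.444] -/
theorem dK1_finset_sum {ι : Type*} (s : Finset ι) (η : ℝ) (ν : Fin 3) (K : ι → ZSite 3 → ZSite 3 → ℝ) (x y : ZSite 3) :
    dK1 η ν (∑ i ∈ s, K i) x y = ∑ i ∈ s, dK1 η ν (K i) x y := by
  simp only [dK1, Finset.sum_apply, Finset.mul_sum, ← Finset.sum_sub_distrib]

/-- kernel: `K∂^{η*}` of a finite sum of kernels. [cite: Balaban1983Higgs3, (3.36) p.444] -/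
theorem dK2_finset_sum {ι : Type*} (s : Finset ι) (η : ℝ) (ν : Fin 3) (K : ι → ZSite 3 → ZSite 3 → ℝ) (x y : ZSite 3) :
    dK2 η ν (∑ i ∈ s, K i) x y = ∑ i ∈ s, dK2 η ν (K i) x y := by
  simp only [dK2, Finset.sum_apply, Finset.mul_sum, ← Finset.sum_sub_distrib]

/-- kernel: `∂^ηK∂^{η*}` of a finite sum of kernels. [cite: Balaban1983Higgs3, (3.36) p.444] -/
theorem d2K_finset_sum {ι : Type*} (s : Finset ι) (η : ℝ) (μ' μ : Fin 3) (K : ι → ZSite 3 → ZSite 3 → ℝ) (x y : ZSite 3) :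
    d2K η μ' μ (∑ i ∈ s, K i) x y = ∑ i ∈ s, d2K η μ' μ (K i) x y := by
  simp only [d2K, Finset.sum_apply, Finset.mul_sum, ← Finset.sum_sub_distrib, ← Finset.sum_add_distrib]

/-- kernel: the (2.20) integrand is additive in the first line. [cite: Balaban1983Higgs3, (3.36) p.444] -/
theorem gam20_sum₁ {ι : Type*} (s : Finset ι) (η : ℝ) (μ : Fin 3) (K₁ : ι → ZSite 3 → ZSite 3 → ℝ)
    (K₂ K₃ : ZSite 3 → ZSite 3 → ℝ) (x x' x'' : ZSite 3) :
    gam20 η μ (∑ i ∈ s, K₁ i) K₂ K₃ x x' x'' = ∑ i ∈ s, gam20 η μ (K₁ i) K₂ K₃ x x' x'' := by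
  simp only [gam20, dK1_finset_sum, d2K_finset_sum, Finset.sum_mul, ← Finset.sum_sub_distrib]
  exact Finset.sum_comm

/-- kernel: the (2.20) integrand is additive in the second line. [cite: Balaban1983Higgs3, (3.36) p.444] -/
theorem gam20_sum₂ {ι : Type*} (s : Finset ι) (η : ℝ) (μ : Fin 3) (K₁ : ZSite 3 → ZSite 3 → ℝ)
    (K₂ : ι → ZSite 3 → ZSite 3 → ℝ) (K₃ : ZSite 3 → ZSite 3 → ℝ) (x x' x'' : ZSite 3) :
    gam20 η μ K₁ (∑ i ∈ s, K₂ i) K₃ x x' x'' = ∑ i ∈ s, gam20 η μ K₁ (K₂ i) K₃ x x' x'' := by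
  simp only [gam20, dK2_finset_sum, d2K_finset_sum, Finset.mul_sum, Finset.sum_mul, ← Finset.sum_sub_distrib]
  exact Finset.sum_comm

/-- kernel: the (2.20) integrand is additive in the third line. [cite: Balaban1983Higgs3, (3.36) p.444] -/
theorem gam20_sum₃ {ι : Type*} (s : Finset ι) (η : ℝ) (μ : Fin 3) (K₁ K₂ : ZSite 3 → ZSite 3 → ℝ)
    (K₃ : ι → ZSite 3 → ZSite 3 → ℝ) (x x' x'' : ZSite 3) :
    gam20 η μ K₁ K₂ (∑ i ∈ s, K₃ i) x x' x'' = ∑ i ∈ s, gam20 η μ K₁ K₂ (K₃ i) x x' x'' := by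
  simp only [gam20, Finset.sum_apply, Finset.mul_sum, ← Finset.sum_sub_distrib]
  exact Finset.sum_comm

/-- kernel: the (2.20) integrand is trilinear in the line kernels — of three finite sums it is the triple sum.
[cite: Balaban1983Higgs3, (3.36) p.444] -/
theorem gam20_sum {ι₁ ι₂ ι₃ : Type*} (s₁ : Finset ι₁) (s₂ : Finset ι₂) (s₃ : Finset ι₃) (η : ℝ) (μ : Fin 3)
    (K₁ : ι₁ → ZSite 3 → ZSite 3 → ℝ) (K₂ : ι₂ → ZSite 3 → ZSite 3 → ℝ) (K₃ : ι₃ → ZSite 3 → ZSite 3 → ℝ)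
    (x x' x'' : ZSite 3) :
    gam20 η μ (∑ i ∈ s₁, K₁ i) (∑ i ∈ s₂, K₂ i) (∑ i ∈ s₃, K₃ i) x x' x'' =
      ∑ i₁ ∈ s₁, ∑ i₂ ∈ s₂, ∑ i₃ ∈ s₃, gam20 η μ (K₁ i₁) (K₂ i₂) (K₃ i₃) x x' x'' := by
  rw [gam20_sum₁]
  refine Finset.sum_congr rfl fun i₁ _ => ?_
  rw [gam20_sum₂]
  refine Finset.sum_congr rfl fun i₂ _ => ?_
  rw [gam20_sum₃]

/-- kernel: the (2.20) kernel `Γ′` is trilinear in the line kernels. [cite: Balaban1983Higgs3, (3.36) p.444] -/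
theorem Gamma20Z_sum {ι₁ ι₂ ι₃ : Type*} (s₁ : Finset ι₁) (s₂ : Finset ι₂) (s₃ : Finset ι₃) (η : ℝ) (T : W →ₗ[ℝ] W)
    (K₁ : ι₁ → KernelZ 2) (K₂ : ι₂ → KernelZ 2) (K₃ : ι₃ → KernelZ 2) :
    Gamma20Z η T (∑ i ∈ s₁, K₁ i) (∑ i ∈ s₂, K₂ i) (∑ i ∈ s₃, K₃ i) =
      ∑ i₁ ∈ s₁, ∑ i₂ ∈ s₂, ∑ i₃ ∈ s₃, Gamma20Z η T (K₁ i₁) (K₂ i₂) (K₃ i₃) := by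
  funext μ x x' x''
  simp only [Gamma20Z, Finset.sum_apply]
  rw [gam20_sum s₁ s₂ s₃ η μ K₁ K₂ K₃ x x' x'']
  simp only [Finset.sum_smul]

/-- **p. 444, the resummation of (3.36) FOR THE GRAPHS (2.20)** — *"we sum the expressions (3.36) over admissible orderings and indices and
we get the expressions of the same type but with propagators G^η_{j₀}(0), G^η_{j₀}"*: summing over the indices `j₁, j₂, j₃ < j₀` of the three
internal lines gives (3.36) with the resummed propagators ((2.6) per line as `B3.Display26`). [cite: Balaban1983Higgs3, (3.36) p.444] -/
theorem local336Z_Gamma20Z_resum (η : ℝ) {j₀ : ℕ} (T : W →ₗ[ℝ] W) {G₁ G₂ G₃ : KernelZ 2} {F₁ F₂ F₃ : ℕ → KernelZ 2}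
    (h₁ : B3.Display26 G₁ F₁ j₀) (h₂ : B3.Display26 G₂ F₂ j₀) (h₃ : B3.Display26 G₃ F₃ j₀)
    (locs : (Fin (2 + 1) → ℤ) → ℝ) (A : Fin (2 + 1) → (Fin (2 + 1) → ℤ) → ℝ) (φ' φ'' : (Fin (2 + 1) → ℤ) → W)
    (Λ Λ' Λ'' : Finset (Fin (2 + 1) → ℤ)) :
    ∑ i₁ ∈ Finset.range j₀, ∑ i₂ ∈ Finset.range j₀, ∑ i₃ ∈ Finset.range j₀,
        local336Z η (Gamma20Z η T (F₁ i₁) (F₂ i₂) (F₃ i₃)) locs A φ' φ'' Λ Λ' Λ'' =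
      local336Z η (Gamma20Z η T G₁ G₂ G₃) locs A φ' φ'' Λ Λ' Λ'' := by
  rw [h₁, h₂, h₃, Gamma20Z_sum, local336Z_finset_sum]
  refine Finset.sum_congr rfl fun i₁ _ => ?_
  rw [local336Z_finset_sum]
  refine Finset.sum_congr rfl fun i₂ _ => ?_
  rw [local336Z_finset_sum]

variable {ℓ k : ℕ} {a m2 : ℝ}

/-- **The resummation AT THE PIECES OF `G_k(ηℤ³, 0)`**: summing (3.36) for the graphs (2.20) with the lines `G^η_{(j₁)}(0)`, `G^η_{(j₂)}(0)`,
`G^η_{(j₃)}(0)` (p26's `gpieceZ`) over `j₁, j₂, j₃ < n` gives (3.36) with p26's resummed `𝒢_n = GresumZ n` in all three slots (`1 ≤ n ≤ k`;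
`𝒢_k = G_k(0)`). [cite: Balaban1983Higgs3, (3.36) p.444] -/
theorem local336Z_Gamma20Z_resum_zeroLattice {n : ℕ} (hn : 1 ≤ n) (hnk : n ≤ k) (T : W →ₗ[ℝ] W)
    (locs : (Fin (2 + 1) → ℤ) → ℝ) (A : Fin (2 + 1) → (Fin (2 + 1) → ℤ) → ℝ) (φ' φ'' : (Fin (2 + 1) → ℤ) → W)
    (Λ Λ' Λ'' : Finset (Fin (2 + 1) → ℤ)) :
    ∑ j₁ ∈ Finset.range n, ∑ j₂ ∈ Finset.range n, ∑ j₃ ∈ Finset.range n,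
        local336Z (etaZ ℓ k) (Gamma20Z (etaZ ℓ k) T (gpieceZ ℓ k j₁ a m2) (gpieceZ ℓ k j₂ a m2) (gpieceZ ℓ k j₃ a m2))
          locs A φ' φ'' Λ Λ' Λ'' =
      local336Z (etaZ ℓ k) (Gamma20Z (etaZ ℓ k) T (GresumZ ℓ k n a m2) (GresumZ ℓ k n a m2) (GresumZ ℓ k n a m2))
        locs A φ' φ'' Λ Λ' Λ'' := by
  have hD : B3.Display26 (GresumZ (d := 2) ℓ k n a m2) (fun j => gpieceZ ℓ k j a m2) n := (sum_gpieceZ_range hn hnk).symm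
  exact local336Z_Gamma20Z_resum (etaZ ℓ k) T hD hD hD locs A φ' φ'' Λ Λ' Λ''

end Factor

/-! ## §2 *"The expression Σ_{x,x″}η^{2d}Γ′_μ(x,x′,x″) is of degree 0, so it is equal to the same expression but on the scale ξ instead
of η"* — the rescaling identities, model-free -/

section Rescale

variable (ξ : ℝ) (K₁ K₂ K₃ : ZSite 3 → ZSite 3 → ℝ)

/-- kernel: `∂K` rescales by `r^{−2}`: `dK1 (rξ) ν (r⁻¹K) = r⁻²·dK1 ξ ν K` (companion of gen 11's `dK2_rescale`).
[cite: Balaban1983Higgs3, (3.36) p.444] -/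
theorem dK1_rescale (r : ℝ) (ν : Fin 3) (x y : ZSite 3) :
    dK1 (r * ξ) ν (fun p q => r⁻¹ * K₁ p q) x y = r⁻¹ ^ 2 * dK1 ξ ν K₁ x y := by
  simp only [dK1, mul_inv]
  ring

/-- **degree 0 for the graphs (2.19)**: two propagators (`r^{−1}` each), one lattice derivative (`r^{−1}`) and the volume element `η³ = r³ξ³`
cancel — `η³γ¹⁹_η[r⁻¹K₁, r⁻¹K₂](x,x′) = ξ³γ¹⁹_ξ[K₁,K₂](x,x′)` for `η = rξ`, `r ≠ 0`. [cite: Balaban1983Higgs3, (3.36)–(3.37) p.444] -/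
theorem gam19_rescale {r : ℝ} (hr : r ≠ 0) (μ : Fin 3) (x x' : ZSite 3) :
    (r * ξ) ^ 3 * gam19 (r * ξ) μ (fun p q => r⁻¹ * K₁ p q) (fun p q => r⁻¹ * K₂ p q) x x' =
      ξ ^ 3 * gam19 ξ μ K₁ K₂ x x' := by
  simp only [gam19, dK1_rescale, B3Eq330EtaZeroLattice.dK2_rescale ξ K₁ r, mul_pow]
  field_simp

/-- **degree 0 for the graphs (2.20)**: three propagators (`r^{−3}`), three lattice derivatives (`r^{−3}`) and the volume element
`η⁶ = r⁶ξ⁶` cancel — `η⁶γ²⁰_η[r⁻¹K₁,r⁻¹K₂,r⁻¹K₃](x,x′,x″) = ξ⁶γ²⁰_ξ[K₁,K₂,K₃](x,x′,x″)` for `η = rξ`, `r ≠ 0`.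
[cite: Balaban1983Higgs3, (3.36)–(3.38) p.444] -/
theorem gam20_rescale {r : ℝ} (hr : r ≠ 0) (μ : Fin 3) (x x' x'' : ZSite 3) :
    (r * ξ) ^ 6 * gam20 (r * ξ) μ (fun p q => r⁻¹ * K₁ p q) (fun p q => r⁻¹ * K₂ p q) (fun p q => r⁻¹ * K₃ p q) x x' x'' =
      ξ ^ 6 * gam20 ξ μ K₁ K₂ K₃ x x' x'' := by
  simp only [gam20, dK1_rescale, B3Eq330EtaZeroLattice.dK2_rescale ξ K₂ r, B3Eq330EtaZeroLattice.d2K_rescale ξ K₁ r,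
    B3Eq330EtaZeroLattice.d2K_rescale ξ K₂ r, mul_pow, Finset.mul_sum]
  refine Finset.sum_congr rfl fun ν _ => ?_
  field_simp

/-- **THE RESCALING SENTENCE FOR THE (2.19) FACTOR, finite window**: `inner19Z (rξ) [r⁻¹K₁, r⁻¹K₂] = inner19Z ξ [K₁,K₂]` on every `Λ`.
[cite: Balaban1983Higgs3, (3.36)–(3.37) p.444] -/
theorem inner19Z_rescale {r : ℝ} (hr : r ≠ 0) (μ : Fin 3) (x' : ZSite 3) (Λ : Finset (ZSite 3)) :
    inner19Z (r * ξ) μ (fun p q => r⁻¹ * K₁ p q) (fun p q => r⁻¹ * K₂ p q) x' Λ = inner19Z ξ μ K₁ K₂ x' Λ := by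
  simp only [inner19Z, gam19_rescale ξ K₁ K₂ hr]

/-- **THE RESCALING SENTENCE FOR THE (2.20) FACTOR, finite windows** — *"The expression Σ_{x,x″}η^{2d}Γ′_μ(x,x′,x″) is of degree 0, so it
is equal to the same expression but on the scale ξ instead of η"*: `inner20Z (rξ) [r⁻¹K₁,r⁻¹K₂,r⁻¹K₃] = inner20Z ξ [K₁,K₂,K₃]` on every
`Λ, Λ″`, for all kernels and every `r ≠ 0`. [cite: Balaban1983Higgs3, (3.36) p.444] -/
theorem inner20Z_rescale {r : ℝ} (hr : r ≠ 0) (μ : Fin 3) (x' : ZSite 3) (Λ Λ'' : Finset (ZSite 3)) :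
    inner20Z (r * ξ) μ (fun p q => r⁻¹ * K₁ p q) (fun p q => r⁻¹ * K₂ p q) (fun p q => r⁻¹ * K₃ p q) x' Λ Λ'' =
      inner20Z ξ μ K₁ K₂ K₃ x' Λ Λ'' := by
  simp only [inner20Z, gam20_rescale ξ K₁ K₂ K₃ hr]

/-- **the same on the whole lattice for (2.19)**: `tri19 (rξ) q³ [r⁻¹K₁, r⁻¹K₂] = tri19 ξ q³ [K₁,K₂]` (termwise, no convergence needed).
[cite: Balaban1983Higgs3, (3.37) p.444] -/
theorem tri19_rescale {r : ℝ} (hr : r ≠ 0) (q3 : ℝ) (μ : Fin 3) (x' : ZSite 3) :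
    tri19 (r * ξ) q3 μ (fun p q => r⁻¹ * K₁ p q) (fun p q => r⁻¹ * K₂ p q) x' = tri19 ξ q3 μ K₁ K₂ x' := by
  simp only [tri19_eq, gam19_rescale ξ K₁ K₂ hr]

/-- **the same on the whole lattice for (2.20)**: `tri20 (rξ) q³ [r⁻¹K₁,r⁻¹K₂,r⁻¹K₃] = tri20 ξ q³ [K₁,K₂,K₃]` (termwise).
[cite: Balaban1983Higgs3, (3.38) p.444] -/
theorem tri20_rescale {r : ℝ} (hr : r ≠ 0) (q3 : ℝ) (μ : Fin 3) (x' : ZSite 3) :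
    tri20 (r * ξ) q3 μ (fun p q => r⁻¹ * K₁ p q) (fun p q => r⁻¹ * K₂ p q) (fun p q => r⁻¹ * K₃ p q) x' =
      tri20 ξ q3 μ K₁ K₂ K₃ x' := by
  simp only [tri20_eq, gam20_rescale ξ K₁ K₂ K₃ hr]

end Rescale

/-! ## §3 At the print's propagator: `η = L^{−k}`, `ξ = L^{−j₀}`, `G^η_{j₀}(0) = GetaL ℓ j₀ k = (L^{j₀}η)^{−1}G^ξ_{j₀}(0)` -/

section Instance

variable {ℓ j₀ k : ℕ} {a m2 : ℝ}

/-- **THE p. 444 RESCALING SENTENCE AT THE PRINT'S PROPAGATOR, for the graphs (2.20)**: with the `η`-lattice reading `G^η_{j₀}(0) = GetaL ℓ j₀ k`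
in the three line slots (`η = L^{−k}`), the (3.36) factor on the windows `Λ, Λ″` EQUALS the factor built on the `ξ = L^{−j₀}`-lattice from
`G^ξ_{j₀}(0) = GxiL ℓ j₀` on the same windows — *"equal to the same expression but on the scale ξ instead of η, ξ = L^{−j₀}"*.
[cite: Balaban1983Higgs3, (3.36) p.444] -/
theorem inner20Z_GetaL_eq (μ : Fin 3) (x' : ZSite 3) (Λ Λ'' : Finset (ZSite 3)) :
    inner20Z (xiOf ℓ k) μ (GetaL ℓ j₀ k a m2) (GetaL ℓ j₀ k a m2) (GetaL ℓ j₀ k a m2) x' Λ Λ'' =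
      inner20Z (xiOf ℓ j₀) μ (GxiL ℓ j₀ a m2) (GxiL ℓ j₀ a m2) (GxiL ℓ j₀ a m2) x' Λ Λ'' := by
  rw [GetaL_eq, xiOf_eq_scale_mul ℓ j₀ k]
  exact inner20Z_rescale (xiOf ℓ j₀) (GxiL ℓ j₀ a m2) (GxiL ℓ j₀ a m2) (GxiL ℓ j₀ a m2) (scale330_pos ℓ j₀ k).ne' μ x' Λ Λ''

/-- the same for the graphs (2.19). [cite: Balaban1983Higgs3, (3.36)–(3.37) p.444] -/
theorem inner19Z_GetaL_eq (μ : Fin 3) (x' : ZSite 3) (Λ : Finset (ZSite 3)) :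
    inner19Z (xiOf ℓ k) μ (GetaL ℓ j₀ k a m2) (GetaL ℓ j₀ k a m2) x' Λ =
      inner19Z (xiOf ℓ j₀) μ (GxiL ℓ j₀ a m2) (GxiL ℓ j₀ a m2) x' Λ := by
  rw [GetaL_eq, xiOf_eq_scale_mul ℓ j₀ k]
  exact inner19Z_rescale (xiOf ℓ j₀) (GxiL ℓ j₀ a m2) (GxiL ℓ j₀ a m2) (scale330_pos ℓ j₀ k).ne' μ x' Λ

/-- the whole-lattice versions: `tri20`/`tri19` at `G^η_{j₀}(0)` on the `η`-lattice equal `tri20`/`tri19` at `G^ξ_{j₀}(0)` on the `ξ`-lattice.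
[cite: Balaban1983Higgs3, (3.37)–(3.38) p.444] -/
theorem tri_GetaL_eq (q3 : ℝ) (μ : Fin 3) (x' : ZSite 3) :
    tri20 (xiOf ℓ k) q3 μ (GetaL ℓ j₀ k a m2) (GetaL ℓ j₀ k a m2) (GetaL ℓ j₀ k a m2) x' =
        tri20 (xiOf ℓ j₀) q3 μ (GxiL ℓ j₀ a m2) (GxiL ℓ j₀ a m2) (GxiL ℓ j₀ a m2) x' ∧
      tri19 (xiOf ℓ k) q3 μ (GetaL ℓ j₀ k a m2) (GetaL ℓ j₀ k a m2) x' =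
        tri19 (xiOf ℓ j₀) q3 μ (GxiL ℓ j₀ a m2) (GxiL ℓ j₀ a m2) x' := by
  rw [GetaL_eq, xiOf_eq_scale_mul ℓ j₀ k]
  exact ⟨tri20_rescale (xiOf ℓ j₀) _ _ _ (scale330_pos ℓ j₀ k).ne' q3 μ x',
    tri19_rescale (xiOf ℓ j₀) _ _ (scale330_pos ℓ j₀ k).ne' q3 μ x'⟩

/-- **hook to p26's resummed pieces**: the (3.36) factor at `𝒢_{j₀} = Σ_{j<j₀}G^η_{(j)}(0) = GresumZ ℓ k j₀ a m²` (the result of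
`local336Z_Gamma20Z_resum_zeroLattice`) is the factor at the `η`-lattice reading `GetaL ℓ j₀ k a (m²/s_{j₀}²)` of the `j₀`-th-step propagator
(p39 g17's `GresumZ_eq_GetaL`, running mass `m²/s²` with `s = L^{k−j₀}`), hence equals the `ξ`-lattice factor of `G^ξ_{j₀}(0)|_{m²/s²}`
(`1 ≤ j₀ ≤ k`, `k ≥ 1`, `a > 0`, `m² ≥ 0`). [cite: Balaban1983Higgs3, (3.36) p.444] -/
theorem GresumZ_inner20Z_eq (hℓ : 1 ≤ ℓ) (hk : 1 ≤ k) (hj1 : 1 ≤ j₀) (hjk : j₀ ≤ k) (ha : 0 < a) (hm : 0 ≤ m2) (μ : Fin 3)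
    (x' : ZSite 3) (Λ Λ'' : Finset (ZSite 3)) :
    inner20Z (xiOf ℓ k) μ (GresumZ (d := 2) ℓ k j₀ a m2) (GresumZ (d := 2) ℓ k j₀ a m2) (GresumZ (d := 2) ℓ k j₀ a m2) x' Λ Λ'' =
      inner20Z (xiOf ℓ j₀) μ (GxiL ℓ j₀ a (m2 / sc ℓ k j₀ ^ 2)) (GxiL ℓ j₀ a (m2 / sc ℓ k j₀ ^ 2))
        (GxiL ℓ j₀ a (m2 / sc ℓ k j₀ ^ 2)) x' Λ Λ'' := by
  rw [GresumZ_eq_GetaL hℓ hk hj1 hjk ha hm]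
  exact inner20Z_GetaL_eq μ x' Λ Λ''

end Instance

/-! ## §4 The `Λ″ ↑ ℤ³`, `Λ ↑ ℤ³` limits of the factor at `G^ξ_{j₀}(0)` -/

section Limits

variable {ℓ k : ℕ} {a m2 : ℝ}

/-- kernel: **the inner (`x″`) series of the (2.20) factor at `G^ξ_k(0)` converges absolutely**, for every `x, x′` — from gen 9's laws
(`|∂G∂^*|, |G∂^*| ≤ C·ξ^{−q}` bounded, `|G(x′,·)| ≤ C·P₁^δ` summable). [cite: Balaban1983Higgs3, (3.38) p.444; (3.16) p.437] -/
theorem summable_gam20_inner (hℓ : 1 ≤ ℓ) (hk : 1 ≤ k) (ha : 0 < a) (hm : 0 ≤ m2) (μ : Fin 3) (x x' : ZSite 3) :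
    Summable fun x'' : ZSite 3 =>
      xiOf ℓ k ^ 6 * gam20 (xiOf ℓ k) μ (GxiL ℓ k a m2) (GxiL ℓ k a m2) (GxiL ℓ k a m2) x x' x'' := by
  obtain ⟨δ, C, K, hδ, hδh, hC1, -, hB⟩ := exists_bounds hℓ a a m2 ha
  have hδ1 : δ ≤ 1 := hδh.trans (by norm_num)
  obtain ⟨⟨g1, -, l3, l4, -, -, -, -, -⟩, -, -, -, -, -, -⟩ := hB k hk a m2 le_rfl le_rfl hm le_rfl
  have hξ := xiOf_pos ℓ k
  have hξ1 := xiOf_le_one ℓ k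
  set ξ := xiOf ℓ k with hξdef
  set G := GxiL ℓ k a m2 with hG
  -- each of the two products, for each ν, is (bounded in x″) × (profile-bounded column)
  have hcol : ∀ w : ZSite 3, |G x' w| ≤ C * prof ξ δ 1 (w - x') := fun w => (g1 x' w).trans_eq (by rw [prof_sub_comm])
  have h1 : ∀ ν : Fin 3, Summable fun w : ZSite 3 =>
      dK1 ξ ν G x' x * d2K ξ μ ν G x w * G x' w := by
    intro ν
    have hb : ∀ w, |dK1 ξ ν G x' x * d2K ξ μ ν G x w| ≤ |dK1 ξ ν G x' x| * (C * (ξ ^ 3)⁻¹) := by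
      intro w
      rw [abs_mul]
      exact mul_le_mul_of_nonneg_left ((l4 μ ν x w).trans
        (mul_le_mul_of_nonneg_left (prof_le_inv hξ hδ.le 3 (x - w)) (by linarith))) (abs_nonneg _)
    exact (summable_abs_bdd_mul_prof hξ hξ1 hδ hδ1 (by norm_num : 1 ≤ 2) x' hb hcol).of_abs
  have h2 : ∀ ν : Fin 3, Summable fun w : ZSite 3 =>
      d2K ξ ν μ G x' x * dK2 ξ ν G x w * G x' w := by
    intro ν
    have hb : ∀ w, |d2K ξ ν μ G x' x * dK2 ξ ν G x w| ≤ |d2K ξ ν μ G x' x| * (C * (ξ ^ 2)⁻¹) := by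
      intro w
      rw [abs_mul]
      exact mul_le_mul_of_nonneg_left ((l3 ν x w).trans
        (mul_le_mul_of_nonneg_left (prof_le_inv hξ hδ.le 2 (x - w)) (by linarith))) (abs_nonneg _)
    exact (summable_abs_bdd_mul_prof hξ hξ1 hδ hδ1 (by norm_num : 1 ≤ 2) x' hb hcol).of_abs
  have hs : Summable fun w : ZSite 3 => gam20 ξ μ G G G x x' w := by
    have := summable_sum (s := (Finset.univ : Finset (Fin 3))) fun ν _ => (h1 ν).sub (h2 ν)
    refine this.congr fun w => ?_
    simp only [gam20]
  exact hs.mul_left _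

/-- kernel: a uniform bound for the inner series — `Σ'_{x″}|ξ⁶γ²⁰(x,x′,x″)| ≤ A·P₂^δ(x′−x)` with `A` independent of `x, x′` (gen 9's
laws + the `L¹` bound `Σ'ξ³P₁ ≤ 833/δ³`), the input of the outer summability. [cite: Balaban1983Higgs3, (3.38) p.444; (3.16) p.437] -/
theorem tsum_abs_gam20_inner_le (hℓ : 1 ≤ ℓ) (hk : 1 ≤ k) (ha : 0 < a) (hm : 0 ≤ m2) :
    ∃ δ A : ℝ, 0 < δ ∧ δ ≤ 1 ∧ 0 ≤ A ∧ ∀ (μ : Fin 3) (x x' : ZSite 3),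
      (Summable fun x'' : ZSite 3 =>
        |xiOf ℓ k ^ 6 * gam20 (xiOf ℓ k) μ (GxiL ℓ k a m2) (GxiL ℓ k a m2) (GxiL ℓ k a m2) x x' x''|) ∧
      ∑' x'' : ZSite 3, |xiOf ℓ k ^ 6 * gam20 (xiOf ℓ k) μ (GxiL ℓ k a m2) (GxiL ℓ k a m2) (GxiL ℓ k a m2) x x' x''| ≤
        A * prof (xiOf ℓ k) δ 2 (x' - x) := by
  obtain ⟨δ, C, K, hδ, hδh, hC1, -, hB⟩ := exists_bounds hℓ a a m2 ha
  have hδ1 : δ ≤ 1 := hδh.trans (by norm_num)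
  have hC : 0 ≤ C := by linarith
  obtain ⟨⟨g1, l2, l3, l4, -, -, -, -, -⟩, -, -, -, -, -, -⟩ := hB k hk a m2 le_rfl le_rfl hm le_rfl
  have hξ := xiOf_pos ℓ k
  have hξ1 := xiOf_le_one ℓ k
  refine ⟨δ, 6 * C ^ 3 * (xiOf ℓ k ^ 3)⁻¹ * (833 / δ ^ 3), hδ, hδ1, by positivity, fun μ x x' => ?_⟩
  set ξ := xiOf ℓ k with hξdef
  set G := GxiL ℓ k a m2 with hG
  -- the summable profile column through x′
  obtain ⟨hsP, hleP⟩ := summable_prof_sub hξ hξ1 hδ hδ1 (by norm_num : 1 ≤ 2) x'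
  have hcol : ∀ w : ZSite 3, |G x' w| ≤ C * prof ξ δ 1 (w - x') := fun w => (g1 x' w).trans_eq (by rw [prof_sub_comm])
  -- crude bounds `C·ξ⁻³` for the differentiated kernels of the middle line
  have hinv32 : (ξ ^ 2)⁻¹ ≤ (ξ ^ 3)⁻¹ := by
    rw [inv_le_inv₀ (by positivity) (by positivity)]
    calc ξ ^ 3 = ξ ^ 2 * ξ := by ring
      _ ≤ ξ ^ 2 * 1 := by gcongr
      _ = ξ ^ 2 := by ring
  have hd3 : ∀ (ν : Fin 3) (w : ZSite 3), |d2K ξ μ ν G x w| ≤ C * (ξ ^ 3)⁻¹ := fun ν w =>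
    (l4 μ ν x w).trans (mul_le_mul_of_nonneg_left (prof_le_inv hξ hδ.le 3 (x - w)) hC)
  have hd2 : ∀ (ν : Fin 3) (w : ZSite 3), |dK2 ξ ν G x w| ≤ C * (ξ ^ 3)⁻¹ := fun ν w =>
    (l3 ν x w).trans (mul_le_mul_of_nonneg_left ((prof_le_inv hξ hδ.le 2 (x - w)).trans hinv32) hC)
  -- the first-line factors are `≤ C·ξ⁻³·P₂(x′−x)` (using `1 ≤ ξ⁻³` and `P₃ ≤ ξ⁻¹P₂ ≤ ξ⁻³P₂`)
  have hP2 := prof_nonneg hξ.le δ 2 (x' - x)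
  have hinv3 : 1 ≤ (ξ ^ 3)⁻¹ := one_le_inv_iff₀.2 ⟨by positivity, pow_le_one₀ hξ.le hξ1⟩
  have hinv13 : ξ⁻¹ ≤ (ξ ^ 3)⁻¹ := by
    rw [inv_le_inv₀ hξ (by positivity)]
    calc ξ ^ 3 = ξ * ξ ^ 2 := by ring
      _ ≤ ξ * 1 := by gcongr; exact pow_le_one₀ hξ.le hξ1
      _ = ξ := by ring
  have hf1 : ∀ ν : Fin 3, |dK1 ξ ν G x' x| ≤ C * (ξ ^ 3)⁻¹ * prof ξ δ 2 (x' - x) := fun ν =>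
    calc |dK1 ξ ν G x' x| ≤ C * prof ξ δ 2 (x' - x) := l2 ν x' x
      _ = C * 1 * prof ξ δ 2 (x' - x) := by ring
      _ ≤ C * (ξ ^ 3)⁻¹ * prof ξ δ 2 (x' - x) := by gcongr
  have hf2 : ∀ ν : Fin 3, |d2K ξ ν μ G x' x| ≤ C * (ξ ^ 3)⁻¹ * prof ξ δ 2 (x' - x) := fun ν =>
    calc |d2K ξ ν μ G x' x| ≤ C * prof ξ δ 3 (x' - x) := l4 ν μ x' x
      _ ≤ C * (ξ⁻¹ * prof ξ δ 2 (x' - x)) := mul_le_mul_of_nonneg_left (prof_succ_le hξ δ 2 (x' - x)) hC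
      _ = C * ξ⁻¹ * prof ξ δ 2 (x' - x) := by ring
      _ ≤ C * (ξ ^ 3)⁻¹ * prof ξ δ 2 (x' - x) := by gcongr
  -- the termwise majorant `6C³ P₂(x′−x) P₁(w−x′) = [6C³ξ⁻³P₂(x′−x)]·[ξ³P₁(w−x′)]`
  have hterm : ∀ w : ZSite 3, |ξ ^ 6 * gam20 ξ μ G G G x x' w| ≤
      6 * C ^ 3 * (ξ ^ 3)⁻¹ * prof ξ δ 2 (x' - x) * (ξ ^ 3 * prof ξ δ 1 (w - x')) := by
    intro w
    have hGw := hcol w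
    have hG0 : 0 ≤ C * prof ξ δ 1 (w - x') := (abs_nonneg _).trans hGw
    have hF0 : 0 ≤ C * (ξ ^ 3)⁻¹ * prof ξ δ 2 (x' - x) := by positivity
    have hν : ∀ ν : Fin 3,
        |dK1 ξ ν G x' x * d2K ξ μ ν G x w * G x' w - d2K ξ ν μ G x' x * dK2 ξ ν G x w * G x' w| ≤
          2 * ((C * (ξ ^ 3)⁻¹ * prof ξ δ 2 (x' - x)) * (C * (ξ ^ 3)⁻¹) * (C * prof ξ δ 1 (w - x'))) := by
      intro ν
      have e1 : |dK1 ξ ν G x' x * d2K ξ μ ν G x w * G x' w| ≤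
          (C * (ξ ^ 3)⁻¹ * prof ξ δ 2 (x' - x)) * (C * (ξ ^ 3)⁻¹) * (C * prof ξ δ 1 (w - x')) := by
        rw [abs_mul, abs_mul]
        exact mul_le_mul (mul_le_mul (hf1 ν) (hd3 ν w) (abs_nonneg _) hF0) hGw (abs_nonneg _) (by positivity)
      have e2 : |d2K ξ ν μ G x' x * dK2 ξ ν G x w * G x' w| ≤
          (C * (ξ ^ 3)⁻¹ * prof ξ δ 2 (x' - x)) * (C * (ξ ^ 3)⁻¹) * (C * prof ξ δ 1 (w - x')) := by
        rw [abs_mul, abs_mul]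
        exact mul_le_mul (mul_le_mul (hf2 ν) (hd2 ν w) (abs_nonneg _) hF0) hGw (abs_nonneg _) (by positivity)
      calc _ ≤ |dK1 ξ ν G x' x * d2K ξ μ ν G x w * G x' w| + |d2K ξ ν μ G x' x * dK2 ξ ν G x w * G x' w| :=
            abs_sub _ _
        _ ≤ _ := by linarith
    have hsumν : |gam20 ξ μ G G G x x' w| ≤
        3 * (2 * ((C * (ξ ^ 3)⁻¹ * prof ξ δ 2 (x' - x)) * (C * (ξ ^ 3)⁻¹) * (C * prof ξ δ 1 (w - x')))) := by
      unfold gam20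
      refine (Finset.abs_sum_le_sum_abs _ _).trans ?_
      have h := Finset.sum_le_sum fun ν (_ : ν ∈ (Finset.univ : Finset (Fin 3))) => hν ν
      rw [Finset.sum_const, Finset.card_univ, Fintype.card_fin, nsmul_eq_mul] at h
      exact_mod_cast h
    rw [abs_mul, abs_of_nonneg (by positivity : (0:ℝ) ≤ ξ ^ 6)]
    calc ξ ^ 6 * |gam20 ξ μ G G G x x' w|
        ≤ ξ ^ 6 * (3 * (2 * ((C * (ξ ^ 3)⁻¹ * prof ξ δ 2 (x' - x)) * (C * (ξ ^ 3)⁻¹) * (C * prof ξ δ 1 (w - x'))))) :=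
          mul_le_mul_of_nonneg_left hsumν (by positivity)
      _ = 6 * C ^ 3 * (ξ ^ 3)⁻¹ * prof ξ δ 2 (x' - x) * (ξ ^ 3 * prof ξ δ 1 (w - x')) * (ξ ^ 3 * (ξ ^ 3)⁻¹) := by ring
      _ = 6 * C ^ 3 * (ξ ^ 3)⁻¹ * prof ξ δ 2 (x' - x) * (ξ ^ 3 * prof ξ δ 1 (w - x')) := by
          rw [mul_inv_cancel₀ (by positivity), mul_one]
  have hmaj : Summable fun w : ZSite 3 =>
      6 * C ^ 3 * (ξ ^ 3)⁻¹ * prof ξ δ 2 (x' - x) * (ξ ^ 3 * prof ξ δ 1 (w - x')) := hsP.mul_left _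
  have hsabs : Summable fun w : ZSite 3 => |ξ ^ 6 * gam20 ξ μ G G G x x' w| :=
    Summable.of_nonneg_of_le (fun _ => abs_nonneg _) hterm hmaj
  refine ⟨hsabs, ?_⟩
  calc ∑' w : ZSite 3, |ξ ^ 6 * gam20 ξ μ G G G x x' w|
      ≤ ∑' w : ZSite 3, 6 * C ^ 3 * (ξ ^ 3)⁻¹ * prof ξ δ 2 (x' - x) * (ξ ^ 3 * prof ξ δ 1 (w - x')) :=
        Summable.tsum_le_tsum hterm hsabs hmaj
    _ = 6 * C ^ 3 * (ξ ^ 3)⁻¹ * prof ξ δ 2 (x' - x) * ∑' w : ZSite 3, ξ ^ 3 * prof ξ δ 1 (w - x') := tsum_mul_left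
    _ ≤ 6 * C ^ 3 * (ξ ^ 3)⁻¹ * prof ξ δ 2 (x' - x) * (833 / δ ^ 3) := by gcongr
    _ = 6 * C ^ 3 * (ξ ^ 3)⁻¹ * (833 / δ ^ 3) * prof ξ δ 2 (x' - x) := by ring

/-- kernel: **the outer (`x`) series of the inner sums converges absolutely** at `G^ξ_k(0)` (comparison with the summable profile column
`P₂^δ(x′ − ·)`). [cite: Balaban1983Higgs3, (3.38) p.444; (3.16) p.437] -/
theorem summable_gam20_outer (hℓ : 1 ≤ ℓ) (hk : 1 ≤ k) (ha : 0 < a) (hm : 0 ≤ m2) (μ : Fin 3) (x' : ZSite 3) :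
    Summable fun x : ZSite 3 => ∑' x'' : ZSite 3,
      xiOf ℓ k ^ 6 * gam20 (xiOf ℓ k) μ (GxiL ℓ k a m2) (GxiL ℓ k a m2) (GxiL ℓ k a m2) x x' x'' := by
  obtain ⟨δ, A, hδ, hδ1, hA, h⟩ := tsum_abs_gam20_inner_le (ℓ := ℓ) (k := k) (a := a) (m2 := m2) hℓ hk ha hm
  have hξ := xiOf_pos ℓ k
  have hξ1 := xiOf_le_one ℓ k
  have hcol := (summable_prof_col hξ hξ1 hδ hδ1 (le_refl 2) x').mul_left A
  refine Summable.of_norm_bounded hcol fun x => ?_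
  obtain ⟨hs, hle⟩ := h μ x x'
  have hs' : Summable fun x'' : ZSite 3 =>
      ‖xiOf ℓ k ^ 6 * gam20 (xiOf ℓ k) μ (GxiL ℓ k a m2) (GxiL ℓ k a m2) (GxiL ℓ k a m2) x x' x''‖ :=
    hs.congr fun x'' => (Real.norm_eq_abs _).symm
  have h1 := norm_tsum_le_tsum_norm hs'
  have h2 : ∑' x'' : ZSite 3, ‖xiOf ℓ k ^ 6 * gam20 (xiOf ℓ k) μ (GxiL ℓ k a m2) (GxiL ℓ k a m2) (GxiL ℓ k a m2) x x' x''‖ =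
      ∑' x'' : ZSite 3, |xiOf ℓ k ^ 6 * gam20 (xiOf ℓ k) μ (GxiL ℓ k a m2) (GxiL ℓ k a m2) (GxiL ℓ k a m2) x x' x''| :=
    tsum_congr fun x'' => Real.norm_eq_abs _
  calc ‖∑' x'' : ZSite 3, xiOf ℓ k ^ 6 * gam20 (xiOf ℓ k) μ (GxiL ℓ k a m2) (GxiL ℓ k a m2) (GxiL ℓ k a m2) x x' x''‖
      ≤ ∑' x'' : ZSite 3, |xiOf ℓ k ^ 6 * gam20 (xiOf ℓ k) μ (GxiL ℓ k a m2) (GxiL ℓ k a m2) (GxiL ℓ k a m2) x x' x''| :=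
        h1.trans_eq h2
    _ ≤ A * prof (xiOf ℓ k) δ 2 (x' - x) := hle
    _ = A * prof (xiOf ℓ k) δ 2 (x - x') := by rw [prof_sub_comm]

/-- **`Λ″ ↑ ℤ³`**: at fixed `Λ`, the finite-window factor of (2.20) converges to the row sums `Σ_{x∈Λ}Σ'_{x″} ξ⁶γ²⁰` (model-free, under
the inner summability). [cite: Balaban1983Higgs3, (3.36) p.444] -/
theorem tendsto_inner20Z_inner (ξ : ℝ) (μ : Fin 3) (K₁ K₂ K₃ : ZSite 3 → ZSite 3 → ℝ) (x' : ZSite 3) (Λ : Finset (ZSite 3))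
    (hs : ∀ x ∈ Λ, Summable fun x'' : ZSite 3 => ξ ^ 6 * gam20 ξ μ K₁ K₂ K₃ x x' x'') :
    Tendsto (fun Λ'' : Finset (ZSite 3) => inner20Z ξ μ K₁ K₂ K₃ x' Λ Λ'') atTop
      (𝓝 (∑ x ∈ Λ, ∑' x'' : ZSite 3, ξ ^ 6 * gam20 ξ μ K₁ K₂ K₃ x x' x'')) := by
  simp only [inner20Z]
  exact tendsto_finsetSum _ fun x hx => (hs x hx).hasSum

/-- **`Λ ↑ ℤ³`**: the row sums converge to the whole-lattice factor `Σ'_xΣ'_{x″} ξ⁶γ²⁰ = −tri20/q³` (model-free, under the outer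
summability). [cite: Balaban1983Higgs3, (3.36) p.444] -/
theorem tendsto_inner20Z_outer (ξ : ℝ) (μ : Fin 3) (K₁ K₂ K₃ : ZSite 3 → ZSite 3 → ℝ) (x' : ZSite 3)
    (hs : Summable fun x : ZSite 3 => ∑' x'' : ZSite 3, ξ ^ 6 * gam20 ξ μ K₁ K₂ K₃ x x' x'') :
    Tendsto (fun Λ : Finset (ZSite 3) => ∑ x ∈ Λ, ∑' x'' : ZSite 3, ξ ^ 6 * gam20 ξ μ K₁ K₂ K₃ x x' x'') atTop
      (𝓝 (∑' x : ZSite 3, ∑' x'' : ZSite 3, ξ ^ 6 * gam20 ξ μ K₁ K₂ K₃ x x' x'')) :=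
  hs.hasSum

/-- **`Λ ↑ ℤ³` for the graphs (2.19)**: the finite-window factor converges to `Σ'_x ξ³γ¹⁹ = −tri19/q³` (model-free, under summability;
at `G^ξ_k(0)` the summability is the first clause of gen 10's `exists_tri19_bound`). [cite: Balaban1983Higgs3, (3.36)–(3.37) p.444] -/
theorem tendsto_inner19Z (ξ : ℝ) (μ : Fin 3) (K₁ K₂ : ZSite 3 → ZSite 3 → ℝ) (x' : ZSite 3)
    (hs : Summable fun x : ZSite 3 => ξ ^ 3 * gam19 ξ μ K₁ K₂ x x') :
    Tendsto (fun Λ : Finset (ZSite 3) => inner19Z ξ μ K₁ K₂ x' Λ) atTop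
      (𝓝 (∑' x : ZSite 3, ξ ^ 3 * gam19 ξ μ K₁ K₂ x x')) := by
  simp only [inner19Z]
  exact hs.hasSum

end Limits

/-! ## §5 Assembly: the (3.36) factor on the print's carrier, rescaled, summed over the whole lattice, and bounded -/

section Assembly

variable {ℓ : ℕ}

/-- **p. 444 FOR THE GRAPHS (2.20) ON THE PRINT'S CARRIER `ηℤ³`** (`d = 3`, zero field, `L = ℓ + 1 ≥ 2`, window `[a₋,a₊] × [0,m²₊]`,
`a₋ > 0`): there is `Cst > 0` (gen 10's) such that for all `1 ≤ j₀ ≤ k` (`η = L^{−k}`, `ξ = L^{−j₀}`), every window point `(a, m²)`, every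
direction `μ` and position `x′`, with `G^η_{j₀}(0) = GetaL ℓ j₀ k a m²` in the three line slots of the (3.36) factor `Σ_{x,x″}η⁶γ²⁰_μ(x,x′,x″)`:
(i) *"equal to the same expression but on the scale ξ"* — on every pair of windows `Λ, Λ″` the `η`-lattice factor equals the `ξ`-lattice
factor of `G^ξ_{j₀}(0) = GxiL ℓ j₀ a m²`; (ii) the `ξ`-lattice factor converges as `Λ″ ↑ ℤ³` (each `Λ`) and then `Λ ↑ ℤ³` to the
whole-lattice factor `F(x′) = Σ'_xΣ'_{x″}ξ⁶γ²⁰`; (iii) `−q³·F(x′) = tri20 ξ q³ [G^ξ_{j₀}(0)]³(x′)`, gen 10's object, and (iv) *"We get a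
convergent expression plus [(3.38)] = 0"* ⟹ `|−q³·F(x′)| ≤ Cst·|q³|` UNIFORMLY in `j₀`, `k`, the window and `x′`
(`B3Eq338ZeroLattice.exists_tri20_bound`). [cite: Balaban1983Higgs3, (3.36)–(3.38) p.444] -/
theorem eq336_factor20_zeroLattice (hℓ : 1 ≤ ℓ) (amin aplus m2plus : ℝ) (ha : 0 < amin) :
    ∃ Cst : ℝ, 0 < Cst ∧ ∀ (j₀ k : ℕ), 1 ≤ j₀ → j₀ ≤ k → ∀ (a m2 : ℝ), amin ≤ a → a ≤ aplus → 0 ≤ m2 → m2 ≤ m2plus →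
      ∀ (q3 : ℝ) (μ : Fin 3) (x' : ZSite 3),
        (∀ Λ Λ'' : Finset (ZSite 3),
          inner20Z (xiOf ℓ k) μ (GetaL ℓ j₀ k a m2) (GetaL ℓ j₀ k a m2) (GetaL ℓ j₀ k a m2) x' Λ Λ'' =
            inner20Z (xiOf ℓ j₀) μ (GxiL ℓ j₀ a m2) (GxiL ℓ j₀ a m2) (GxiL ℓ j₀ a m2) x' Λ Λ'') ∧
        (∀ Λ : Finset (ZSite 3), Tendsto (fun Λ'' : Finset (ZSite 3) =>
            inner20Z (xiOf ℓ j₀) μ (GxiL ℓ j₀ a m2) (GxiL ℓ j₀ a m2) (GxiL ℓ j₀ a m2) x' Λ Λ'') atTop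
          (𝓝 (∑ x ∈ Λ, ∑' x'' : ZSite 3,
            xiOf ℓ j₀ ^ 6 * gam20 (xiOf ℓ j₀) μ (GxiL ℓ j₀ a m2) (GxiL ℓ j₀ a m2) (GxiL ℓ j₀ a m2) x x' x''))) ∧
        Tendsto (fun Λ : Finset (ZSite 3) => ∑ x ∈ Λ, ∑' x'' : ZSite 3,
            xiOf ℓ j₀ ^ 6 * gam20 (xiOf ℓ j₀) μ (GxiL ℓ j₀ a m2) (GxiL ℓ j₀ a m2) (GxiL ℓ j₀ a m2) x x' x'') atTop
          (𝓝 (∑' x : ZSite 3, ∑' x'' : ZSite 3,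
            xiOf ℓ j₀ ^ 6 * gam20 (xiOf ℓ j₀) μ (GxiL ℓ j₀ a m2) (GxiL ℓ j₀ a m2) (GxiL ℓ j₀ a m2) x x' x'')) ∧
        -q3 * (∑' x : ZSite 3, ∑' x'' : ZSite 3,
            xiOf ℓ j₀ ^ 6 * gam20 (xiOf ℓ j₀) μ (GxiL ℓ j₀ a m2) (GxiL ℓ j₀ a m2) (GxiL ℓ j₀ a m2) x x' x'') =
          tri20 (xiOf ℓ j₀) q3 μ (GxiL ℓ j₀ a m2) (GxiL ℓ j₀ a m2) (GxiL ℓ j₀ a m2) x' ∧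
        |tri20 (xiOf ℓ j₀) q3 μ (GxiL ℓ j₀ a m2) (GxiL ℓ j₀ a m2) (GxiL ℓ j₀ a m2) x'| ≤ Cst * |q3| := by
  obtain ⟨Cst, hCst, hB⟩ := exists_tri20_bound hℓ amin aplus m2plus ha
  refine ⟨Cst, hCst, ?_⟩
  intro j₀ k hj hjk a m2 ha1 ha2 hm1 hm2 q3 μ x'
  have ha' : 0 < a := ha.trans_le ha1
  obtain ⟨-, -, -, hiv⟩ := hB j₀ hj a m2 a m2 ha1 ha2 hm1 hm2 ha1 ha2 hm1 hm2 q3 μ x'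
  refine ⟨fun Λ Λ'' => inner20Z_GetaL_eq μ x' Λ Λ'', fun Λ => ?_, ?_, (tri20_eq _ q3 μ _ _ _ x').symm, hiv⟩
  · exact tendsto_inner20Z_inner _ μ _ _ _ x' Λ fun x _ => summable_gam20_inner hℓ hj ha' hm1 μ x x'
  · exact tendsto_inner20Z_outer _ μ _ _ _ x' (summable_gam20_outer hℓ hj ha' hm1 μ x')

/-- **p. 444 FOR THE GRAPHS (2.19) ON THE PRINT'S CARRIER `ηℤ³`**, same shape: (i) the `η`-lattice factor `Σ_{x∈Λ}η³γ¹⁹_μ(x,x′)` at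
`G^η_{j₀}(0)` equals the `ξ`-lattice factor at `G^ξ_{j₀}(0)` on every window; (ii) it converges as `Λ ↑ ℤ³`; (iii) `−q³·(limit) = tri19`;
(iv) *"This expression for the graphs (2.19) equals [(3.37)] = 0"* after the replacement ⟹ `|tri19| ≤ Cst·|q³|` uniformly (gen 10's
`B3Eq337ZeroLattice.exists_tri19_bound`). [cite: Balaban1983Higgs3, (3.36)–(3.37) p.444] -/
theorem eq336_factor19_zeroLattice (hℓ : 1 ≤ ℓ) (amin aplus m2plus : ℝ) (ha : 0 < amin) :
    ∃ Cst : ℝ, 0 < Cst ∧ ∀ (j₀ k : ℕ), 1 ≤ j₀ → j₀ ≤ k → ∀ (a m2 : ℝ), amin ≤ a → a ≤ aplus → 0 ≤ m2 → m2 ≤ m2plus →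
      ∀ (q3 : ℝ) (μ : Fin 3) (x' : ZSite 3),
        (∀ Λ : Finset (ZSite 3),
          inner19Z (xiOf ℓ k) μ (GetaL ℓ j₀ k a m2) (GetaL ℓ j₀ k a m2) x' Λ =
            inner19Z (xiOf ℓ j₀) μ (GxiL ℓ j₀ a m2) (GxiL ℓ j₀ a m2) x' Λ) ∧
        Tendsto (fun Λ : Finset (ZSite 3) => inner19Z (xiOf ℓ j₀) μ (GxiL ℓ j₀ a m2) (GxiL ℓ j₀ a m2) x' Λ) atTop
          (𝓝 (∑' x : ZSite 3, xiOf ℓ j₀ ^ 3 * gam19 (xiOf ℓ j₀) μ (GxiL ℓ j₀ a m2) (GxiL ℓ j₀ a m2) x x')) ∧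
        -q3 * (∑' x : ZSite 3, xiOf ℓ j₀ ^ 3 * gam19 (xiOf ℓ j₀) μ (GxiL ℓ j₀ a m2) (GxiL ℓ j₀ a m2) x x') =
          tri19 (xiOf ℓ j₀) q3 μ (GxiL ℓ j₀ a m2) (GxiL ℓ j₀ a m2) x' ∧
        |tri19 (xiOf ℓ j₀) q3 μ (GxiL ℓ j₀ a m2) (GxiL ℓ j₀ a m2) x'| ≤ Cst * |q3| := by
  obtain ⟨Cst, hCst, hB⟩ := exists_tri19_bound hℓ amin aplus m2plus ha
  refine ⟨Cst, hCst, ?_⟩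
  intro j₀ k hj hjk a m2 ha1 ha2 hm1 hm2 q3 μ x'
  obtain ⟨hs, -, -, hiv⟩ := hB j₀ hj a m2 a m2 ha1 ha2 hm1 hm2 ha1 ha2 hm1 hm2 q3 μ x'
  refine ⟨fun Λ => inner19Z_GetaL_eq μ x' Λ, ?_, (tri19_eq _ q3 μ _ _ x').symm, hiv⟩
  exact tendsto_inner19Z _ μ _ _ x' (hs.congr fun x => by simp only [gam19])

end Assembly

end

end Literature.MathematicalPhysics.QuantumFieldTheory.Balaban1983to89.B3Eq336ScaleZeroLattice
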